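import Summits.Parity.GeneralizedHardyLittlewood.Theorems.LiouvilleShiftedTablesEngineToPairsDefs
import Literature.NumberTheory.Sieve.ParityBarrier

/-!
# The hinge `TAvg` from the correlation sieve and the three budgets (stub `stub_TAvg_of_parts`)

Line `Sketch` of the crux `EngineToPairs` (stmt-Parity-14659), route `LiouvilleShiftedTables`; vocabulary
in `Theorems/LiouvilleShiftedTablesEngineToPairsDefs.lean`.  Pure glue:
`stub_TAvg_of_parts : CorrelationSieveFamily → TIBudget → TIIBudget → TI2Budget → TAvg` with
`δ = min (ρ/3) (1/100)` (`ρ` from `TI2Budget h`), `ε₁ = δ/8` for the budgets (taken at the exponent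
`A + |C|`, `C` the sieve constant), `ε = δ/16` for `TAvgAt h`.  Moduli `q ≤ x^ε` NOT coprime to `h`: the
class `n ≡ h (q)` consists of multiples of `g = (q, h) ≥ 2`, of von Mangoldt mass `≤ log N` up to `N`
(`sum_vonMangoldt_filter_dvd_le`).  Coprime moduli: halving induction on the height `y`
(`halving_induction`): below `√x` the trivial bound, on `[√x, x]` the top half `(y/2, y]` is one
application of the sieve at the scale `y` with the budgets restricted from `moduliH h (y^{ε₁})` to
`moduliH h (x^ε)` (`x^{δ/16} ≤ y^{δ/8}`, the information predicates being monotone in the family).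
-/

noncomputable section

namespace Summit.Parity.GeneralizedHardyLittlewood.Theorems.EngineToPairs

open Finset Real Filter
open scoped ArithmeticFunction.vonMangoldt

namespace TAvgOfParts

/-- `TypeIFam` is monotone in the family (smaller family, larger budget). [folklore] -/
theorem TypeIFam_mono {Qs Qs' : Finset ℕ} {w : ℕ → ℕ → ℝ} {x γ : ℝ} {B : ℕ} {T T' : ℝ}
    (hQ : Qs ⊆ Qs') (hT : T' ≤ T) (hF : TypeIFam Qs' w x γ B T') : TypeIFam Qs w x γ B T :=
  fun I => le_trans (Finset.sum_le_sum_of_subset_of_nonneg hQ fun _ _ _ =>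
    Finset.sum_nonneg fun m _ => mul_nonneg (tauPow_nonneg B m) (abs_nonneg _)) ((hF I).trans hT)

/-- `TypeIIFam` is monotone in the family (smaller family, larger budget). [folklore] -/
theorem TypeIIFam_mono {Qs Qs' : Finset ℕ} {w : ℕ → ℕ → ℝ} {x θ ν : ℝ} {B : ℕ} {T T' : ℝ}
    (hQ : Qs ⊆ Qs') (hT : T' ≤ T) (hF : TypeIIFam Qs' w x θ ν B T') :
    TypeIIFam Qs w x θ ν B T :=
  fun ξ κ hξ hκ => le_trans (Finset.sum_le_sum_of_subset_of_nonneg hQ fun _ _ _ => abs_nonneg _)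
    ((hF ξ κ hξ hκ).trans hT)

/-- `TypeI2Fam` is monotone in the family (smaller family, larger budget). [folklore] -/
theorem TypeI2Fam_mono {Qs Qs' : Finset ℕ} {w : ℕ → ℕ → ℝ} {x ρ σ : ℝ} {B : ℕ} {T T' : ℝ}
    (hQ : Qs ⊆ Qs') (hT : T' ≤ T) (hF : TypeI2Fam Qs' w x ρ σ B T') :
    TypeI2Fam Qs w x ρ σ B T :=
  fun R S y hR1 hR hS hSR hy0 hy => le_trans (Finset.sum_le_sum_of_subset_of_nonneg hQ
    fun _ _ _ => Finset.sum_nonneg fun r _ => mul_nonneg (tauPow_nonneg B r) (abs_nonneg _))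
      ((hF R S y hR1 hR hS hSR hy0 hy).trans hT)

/-- `moduliH h` is monotone in the level. [folklore] -/
theorem moduliH_mono {h : ℕ} {Q Q' : ℝ} (hQ : Q ≤ Q') : moduliH h Q ⊆ moduliH h Q' := by
  intro q hq
  rw [mem_moduliH] at hq ⊢
  exact ⟨⟨hq.1.1, hq.1.2.trans (Nat.floor_mono hQ)⟩, hq.2⟩

/-- `#{q ∈ Icc 1 ⌊Q⌋₊ : p q} ≤ Q`. [folklore] -/
theorem card_filter_Icc_le {Q : ℝ} (hQ : 0 ≤ Q) (p : ℕ → Prop) [DecidablePred p] :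
    ((((Icc 1 ⌊Q⌋₊).filter p).card : ℕ) : ℝ) ≤ Q := by
  calc ((((Icc 1 ⌊Q⌋₊).filter p).card : ℕ) : ℝ) ≤ ((Icc 1 ⌊Q⌋₊).card : ℕ) := by
        exact_mod_cast Finset.card_filter_le _ _
    _ = ⌊Q⌋₊ := by rw [Nat.card_Icc, Nat.add_sub_cancel]
    _ ≤ Q := Nat.floor_le hQ

/-- For `g ≥ 2` the von Mangoldt mass of the multiples of `g` up to `N` is at most `log N`: they are
powers of the least prime factor `p` of `g` and divide the largest power of `p` below `N`. [folklore] -/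
theorem sum_vonMangoldt_filter_dvd_le {g : ℕ} (hg : 2 ≤ g) (N : ℕ) :
    ∑ n ∈ (Icc 1 N).filter (fun n : ℕ => g ∣ n), Λ n ≤ Real.log N := by
  rcases Nat.eq_zero_or_pos N with rfl | hN
  · simp
  have hp : g.minFac.Prime := Nat.minFac_prime (by omega)
  have hpK : g.minFac ^ Nat.log g.minFac N ≤ N := Nat.pow_log_le_self _ hN.ne'
  rw [← Finset.sum_filter_ne_zero]
  calc ∑ n ∈ ((Icc 1 N).filter (fun n : ℕ => g ∣ n)).filter (fun n => Λ n ≠ 0), Λ n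
      ≤ ∑ d ∈ (g.minFac ^ Nat.log g.minFac N).divisors, Λ d := by
        refine Finset.sum_le_sum_of_subset_of_nonneg (fun n hn => ?_)
          fun _ _ _ => ArithmeticFunction.vonMangoldt_nonneg
        simp only [Finset.mem_filter, Finset.mem_Icc] at hn
        obtain ⟨⟨⟨-, hnN⟩, hgn⟩, hΛ⟩ := hn
        obtain ⟨r, k, hr, -, rfl⟩ :=
          (isPrimePow_nat_iff _).1 (ArithmeticFunction.vonMangoldt_ne_zero_iff.1 hΛ)
        obtain ⟨i, -, hgi⟩ := (Nat.dvd_prime_pow hr).1 hgn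
        have hi : i ≠ 0 := by rintro rfl; rw [pow_zero] at hgi; omega
        have hrp : g.minFac = r := by rw [hgi, hr.pow_minFac hi]
        rw [hrp, Nat.mem_divisors]
        exact ⟨pow_dvd_pow r (Nat.le_log_of_pow_le hr.one_lt hnN), pow_ne_zero _ hr.ne_zero⟩
    _ = Real.log ((g.minFac ^ Nat.log g.minFac N : ℕ) : ℝ) := ArithmeticFunction.vonMangoldt_sum
    _ ≤ Real.log N :=
        Real.log_le_log (by exact_mod_cast pow_pos hp.pos _) (by exact_mod_cast hpK)

/-- A class `n ≡ h (mod q)` with `(q, h) > 1` carries von Mangoldt mass `≤ log N` up to `N`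
(its members are multiples of `(q, h) ≥ 2`; `|λ| ≤ 1` is the tree's
`Literature.NumberTheory.Sieve.abs_liouville_le_one`). [folklore] -/
theorem abs_inner_le_log_of_not_coprime {h q : ℕ} (hh : 1 ≤ h) (hq : ¬ Nat.Coprime q h) (N : ℕ) :
    |∑ n ∈ (Icc 1 N).filter (fun n : ℕ => n ≡ h [MOD q]),
        Λ n * (ArithmeticFunction.liouville (n - h) : ℝ)| ≤ Real.log N := by
  have hg2 : 2 ≤ Nat.gcd q h := by
    have h0 : Nat.gcd q h ≠ 0 := fun h0 => by
      have := (Nat.gcd_eq_zero_iff.1 h0).2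
      omega
    have h1 : Nat.gcd q h ≠ 1 := hq
    omega
  calc |∑ n ∈ (Icc 1 N).filter (fun n : ℕ => n ≡ h [MOD q]),
          Λ n * (ArithmeticFunction.liouville (n - h) : ℝ)|
      ≤ ∑ n ∈ (Icc 1 N).filter (fun n : ℕ => n ≡ h [MOD q]),
          |Λ n * (ArithmeticFunction.liouville (n - h) : ℝ)| := Finset.abs_sum_le_sum_abs _ _
    _ ≤ ∑ n ∈ (Icc 1 N).filter (fun n : ℕ => n ≡ h [MOD q]), Λ n := by
        refine Finset.sum_le_sum fun n _ => ?_
        rw [abs_mul, abs_of_nonneg ArithmeticFunction.vonMangoldt_nonneg]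
        exact mul_le_of_le_one_right ArithmeticFunction.vonMangoldt_nonneg
          (Literature.NumberTheory.Sieve.abs_liouville_le_one _)
    _ ≤ ∑ n ∈ (Icc 1 N).filter (fun n : ℕ => Nat.gcd q h ∣ n), Λ n := by
        refine Finset.sum_le_sum_of_subset_of_nonneg (fun n hn => ?_)
          fun _ _ _ => ArithmeticFunction.vonMangoldt_nonneg
        rw [Finset.mem_filter] at hn ⊢
        refine ⟨hn.1, Nat.modEq_zero_iff_dvd.1 ?_⟩
        exact (Nat.ModEq.of_dvd (Nat.gcd_dvd_left q h) hn.2).trans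
          (Nat.modEq_zero_iff_dvd.2 (Nat.gcd_dvd_right q h))
    _ ≤ Real.log N := sum_vonMangoldt_filter_dvd_le hg2 N

/-- Trivial bound: `∑_{q ∈ Qs} |∑_{n ≤ y} Λ(n) w_{h,q}(n)| ≤ #Qs · y log x` for `0 ≤ y ≤ x`, `1 ≤ x`.
[folklore] -/
theorem sum_abs_le_card_mul {h : ℕ} (Qs : Finset ℕ) {y x : ℝ} (hy : 0 ≤ y) (hyx : y ≤ x)
    (hx : 1 ≤ x) :
    ∑ q ∈ Qs, |∑ n ∈ Icc 1 ⌊y⌋₊, Λ n * shiftWeight h q n| ≤ (Qs.card : ℝ) * (y * Real.log x) := by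
  have hΛ : ∀ n ∈ Icc 1 ⌊y⌋₊, Λ n ≤ Real.log x := by
    intro n hn
    rw [Finset.mem_Icc] at hn
    have hn1 : (1 : ℝ) ≤ n := by exact_mod_cast hn.1
    have hny : (n : ℝ) ≤ y := (Nat.cast_le.2 hn.2).trans (Nat.floor_le hy)
    exact ArithmeticFunction.vonMangoldt_le_log.trans
      (Real.log_le_log (by linarith) (hny.trans hyx))
  have hq : ∀ q ∈ Qs, |∑ n ∈ Icc 1 ⌊y⌋₊, Λ n * shiftWeight h q n| ≤ y * Real.log x := by
    intro q _
    calc |∑ n ∈ Icc 1 ⌊y⌋₊, Λ n * shiftWeight h q n|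
        ≤ ∑ n ∈ Icc 1 ⌊y⌋₊, |Λ n * shiftWeight h q n| := Finset.abs_sum_le_sum_abs _ _
      _ ≤ ∑ n ∈ Icc 1 ⌊y⌋₊, Real.log x := Finset.sum_le_sum fun n hn => by
          rw [abs_mul, abs_of_nonneg ArithmeticFunction.vonMangoldt_nonneg]
          exact (mul_le_of_le_one_right ArithmeticFunction.vonMangoldt_nonneg
            (abs_shiftWeight_le_one h q n)).trans (hΛ n hn)
      _ = (⌊y⌋₊ : ℝ) * Real.log x := by
          rw [Finset.sum_const, Nat.card_Icc, Nat.add_sub_cancel, nsmul_eq_mul]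
      _ ≤ y * Real.log x := mul_le_mul_of_nonneg_right (Nat.floor_le hy) (Real.log_nonneg hx)
  calc ∑ q ∈ Qs, |∑ n ∈ Icc 1 ⌊y⌋₊, Λ n * shiftWeight h q n|
      ≤ ∑ q ∈ Qs, y * Real.log x := Finset.sum_le_sum hq
    _ = (Qs.card : ℝ) * (y * Real.log x) := by rw [Finset.sum_const, nsmul_eq_mul]

/-- Halving step for the family sum: `L(y) ≤ L(y/2) + P(y)`, from
`Icc 1 ⌊y⌋₊ = Icc 1 ⌊y/2⌋₊ ∪ Ioc ⌊y/2⌋₊ ⌊y⌋₊`. [folklore] -/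
theorem sum_abs_le_half_add {h : ℕ} (Qs : Finset ℕ) {y : ℝ} (hy : 0 ≤ y) :
    ∑ q ∈ Qs, |∑ n ∈ Icc 1 ⌊y⌋₊, Λ n * shiftWeight h q n| ≤
      ∑ q ∈ Qs, |∑ n ∈ Icc 1 ⌊y / 2⌋₊, Λ n * shiftWeight h q n| +
        ∑ q ∈ Qs, |∑ n ∈ Ioc ⌊y / 2⌋₊ ⌊y⌋₊, Λ n * shiftWeight h q n| := by
  have h1 : ∀ N : ℕ, Icc 1 N = Ioc 0 N := fun N => by
    ext n; simp only [Finset.mem_Icc, Finset.mem_Ioc]; omega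
  rw [← Finset.sum_add_distrib]
  refine Finset.sum_le_sum fun q _ => ?_
  rw [h1, h1, ← Finset.sum_Ioc_consecutive _ (Nat.zero_le _) (Nat.floor_mono (half_le_self hy))]
  exact abs_add_le _ _

/-- Abstract halving induction: if `L ≤ Sm` below `s`, `L(y) ≤ L(y/2) + P(y)` and `P(y) ≤ K y` on
`[s, x]`, then `L(y) ≤ Sm + 2 K y` on `[0, x]`. [folklore] -/
theorem halving_induction {L P : ℝ → ℝ} {s x Sm K : ℝ} (hs : 0 < s) (hK : 0 ≤ K)
    (h1 : ∀ y, 0 ≤ y → y ≤ x → y < s → L y ≤ Sm)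
    (h2 : ∀ y, s ≤ y → y ≤ x → L y ≤ L (y / 2) + P y)
    (h3 : ∀ y, s ≤ y → y ≤ x → P y ≤ K * y) :
    ∀ y, 0 ≤ y → y ≤ x → L y ≤ Sm + 2 * K * y := by
  suffices H : ∀ n : ℕ, ∀ y, y < 2 ^ n * s → 0 ≤ y → y ≤ x → L y ≤ Sm + 2 * K * y by
    intro y hy0 hyx
    obtain ⟨n, hn⟩ := pow_unbounded_of_one_lt (y / s) (one_lt_two (α := ℝ))
    exact H n y ((div_lt_iff₀ hs).1 hn) hy0 hyx
  intro n
  induction n with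
  | zero =>
    intro y hys hy0 hyx
    rw [pow_zero, one_mul] at hys
    have := h1 y hy0 hyx hys
    have := mul_nonneg hK hy0
    linarith
  | succ n ih =>
    intro y hys hy0 hyx
    rcases lt_or_ge y s with hlt | hle
    · have := h1 y hy0 hyx hlt
      have := mul_nonneg hK hy0
      linarith
    · have h2n : (2 : ℝ) ^ (n + 1) * s = 2 * (2 ^ n * s) := by ring
      rw [h2n] at hys
      have hih := ih (y / 2) (by linarith) (by linarith) (by linarith)
      have := h2 y hle hyx
      have := h3 y hle hyx
      linarith

/-- `x^{δ/16} ≤ x'^{δ/8}` for `√x ≤ x'`. [folklore] -/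
theorem rpow_sixteenth_le {x x' δ : ℝ} (hx : 0 ≤ x) (hδ : 0 ≤ δ) (hx' : x ^ (1 / 2 : ℝ) ≤ x') :
    x ^ (δ / 16) ≤ x' ^ (δ / 8) := by
  have h : x ^ (δ / 16) = (x ^ (1 / 2 : ℝ)) ^ (δ / 8) := by
    rw [← Real.rpow_mul hx]; congr 1; ring
  rw [h]
  exact Real.rpow_le_rpow (Real.rpow_nonneg hx _) hx' (by positivity)

/-- One dyadic piece: the sieve inequality at the scale `x'` for the family `moduliH h Q`,
`Q ≤ x'^{ε₁}`, fed with the three budgets (restricted to the sub-family, constants replaced by their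
absolute values). [this line] -/
theorem piece_le {h B : ℕ} {δ ε₁ A' Cs C₁ C₂ C₃ x' Q : ℝ}
    (hsieve : ∀ Qs : Finset ℕ, ∀ w : ℕ → ℕ → ℝ, (∀ q n, |w q n| ≤ 1) →
      ∀ TI TII TI2 : ℝ, 0 ≤ TI → 0 ≤ TII → 0 ≤ TI2 →
        TypeIFam Qs w x' (1 / 2 - 2 * δ) B TI →
        TypeIIFam Qs w x' (δ / 2) (1 / 3 + δ / 2) B TII →
        TypeI2Fam Qs w x' δ (3 * δ) B TI2 →
          ∑ q ∈ Qs, |∑ n ∈ Ioc ⌊x' / 2⌋₊ ⌊x'⌋₊, Λ n * w q n| ≤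
            Cs * Real.log x' ^ Cs * (TI + TII + TI2))
    (hI : TypeIFam (moduliH h (x' ^ ε₁)) (shiftWeight h) x' (1 / 2 - 2 * δ) B
      (C₁ * x' / Real.log x' ^ A'))
    (hII : TypeIIFam (moduliH h (x' ^ ε₁)) (shiftWeight h) x' (δ / 2) (1 / 3 + δ / 2) B
      (C₂ * x' / Real.log x' ^ A'))
    (hI2 : TypeI2Fam (moduliH h (x' ^ ε₁)) (shiftWeight h) x' δ (3 * δ) B
      (C₃ * x' / Real.log x' ^ A'))
    (hQ : Q ≤ x' ^ ε₁) (hx' : 1 < x') :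
    ∑ q ∈ moduliH h Q, |∑ n ∈ Ioc ⌊x' / 2⌋₊ ⌊x'⌋₊, Λ n * shiftWeight h q n| ≤
      |Cs| * Real.log x' ^ Cs * ((|C₁| + |C₂| + |C₃|) * x' / Real.log x' ^ A') := by
  have hL : 0 < Real.log x' := Real.log_pos hx'
  have hLA : 0 < Real.log x' ^ A' := Real.rpow_pos_of_pos hL _
  have hx0 : 0 ≤ x' := by linarith
  have hT : ∀ C : ℝ, C * x' / Real.log x' ^ A' ≤ |C| * x' / Real.log x' ^ A' := fun C =>
    div_le_div_of_nonneg_right (mul_le_mul_of_nonneg_right (le_abs_self C) hx0) hLA.le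
  have hT0 : ∀ C : ℝ, 0 ≤ |C| * x' / Real.log x' ^ A' := fun C =>
    div_nonneg (mul_nonneg (abs_nonneg C) hx0) hLA.le
  have hsub : moduliH h Q ⊆ moduliH h (x' ^ ε₁) := moduliH_mono hQ
  refine (hsieve (moduliH h Q) (shiftWeight h) (abs_shiftWeight_le_one h) _ _ _ (hT0 C₁) (hT0 C₂)
    (hT0 C₃) (TypeIFam_mono hsub (hT C₁) hI) (TypeIIFam_mono hsub (hT C₂) hII)
    (TypeI2Fam_mono hsub (hT C₃) hI2)).trans ?_
  have hsum : |C₁| * x' / Real.log x' ^ A' + |C₂| * x' / Real.log x' ^ A' +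
      |C₃| * x' / Real.log x' ^ A' = (|C₁| + |C₂| + |C₃|) * x' / Real.log x' ^ A' := by ring
  rw [hsum]
  have hnn : 0 ≤ Real.log x' ^ Cs * ((|C₁| + |C₂| + |C₃|) * x' / Real.log x' ^ A') :=
    mul_nonneg (Real.rpow_nonneg hL.le _) (div_nonneg (mul_nonneg (by positivity) hx0) hLA.le)
  calc Cs * Real.log x' ^ Cs * ((|C₁| + |C₂| + |C₃|) * x' / Real.log x' ^ A')
      = Cs * (Real.log x' ^ Cs * ((|C₁| + |C₂| + |C₃|) * x' / Real.log x' ^ A')) := by ring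
    _ ≤ |Cs| * (Real.log x' ^ Cs * ((|C₁| + |C₂| + |C₃|) * x' / Real.log x' ^ A')) :=
        mul_le_mul_of_nonneg_right (le_abs_self Cs) hnn
    _ = _ := by ring

/-- Exponent bookkeeping: with `1 ≤ L` and `0 < Lx ≤ 2L`,
`|Cs| L^{Cs} · M x'/L^{A+|Cs|} ≤ 2^A |Cs| M x' / Lx^A`. [folklore] -/
theorem const_bookkeeping {L Lx Cs A M x' : ℝ} (hL : 1 ≤ L) (hLx0 : 0 < Lx) (hLx : Lx ≤ 2 * L)
    (hA : 0 ≤ A) (hM : 0 ≤ M) (hx' : 0 ≤ x') :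
    |Cs| * L ^ Cs * (M * x' / L ^ (A + |Cs|)) ≤ 2 ^ A * |Cs| * M * x' / Lx ^ A := by
  have hL0 : 0 < L := by linarith
  have h1 : L ^ Cs / L ^ (A + |Cs|) ≤ (L ^ A)⁻¹ := by
    rw [← Real.rpow_sub hL0, ← Real.rpow_neg hL0.le]
    exact Real.rpow_le_rpow_of_exponent_le hL (by linarith [le_abs_self Cs])
  have h2 : (L ^ A)⁻¹ ≤ 2 ^ A / Lx ^ A := by
    have h : Lx ^ A ≤ (2 : ℝ) ^ A * L ^ A := by
      rw [← Real.mul_rpow (by norm_num) hL0.le]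
      exact Real.rpow_le_rpow hLx0.le hLx hA
    rw [le_div_iff₀ (Real.rpow_pos_of_pos hLx0 _), inv_mul_le_iff₀ (Real.rpow_pos_of_pos hL0 _),
      mul_comm]
    exact h
  calc |Cs| * L ^ Cs * (M * x' / L ^ (A + |Cs|))
      = |Cs| * M * x' * (L ^ Cs / L ^ (A + |Cs|)) := by ring
    _ ≤ |Cs| * M * x' * (2 ^ A / Lx ^ A) :=
        mul_le_mul_of_nonneg_left (h1.trans h2) (by positivity)
    _ = 2 ^ A * |Cs| * M * x' / Lx ^ A := by ring

/-- The thresholds in `x`: `1 ≤ x`, `T ≤ √x`, `9 ≤ √x` and `2 (log x)^{A+1} ≤ x^{1/4}` eventually.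
[folklore] -/
theorem eventually_thresholds (A T : ℝ) : ∀ᶠ x : ℝ in atTop,
    1 ≤ x ∧ T ≤ x ^ (1 / 2 : ℝ) ∧ 9 ≤ x ^ (1 / 2 : ℝ) ∧
      2 * Real.log x ^ (A + 1) ≤ x ^ (1 / 4 : ℝ) := by
  refine (eventually_ge_atTop 1).and
    (((tendsto_rpow_atTop (by norm_num)).eventually_ge_atTop T).and
      (((tendsto_rpow_atTop (by norm_num)).eventually_ge_atTop 9).and ?_))
  filter_upwards [(isLittleO_log_rpow_rpow_atTop (A + 1) (by norm_num : (0 : ℝ) < 1 / 4)).bound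
    (by norm_num : (0 : ℝ) < 1 / 2), eventually_ge_atTop (1 : ℝ)] with x hx hx1
  rw [Real.norm_of_nonneg (Real.rpow_nonneg (Real.log_nonneg hx1) _),
    Real.norm_of_nonneg (Real.rpow_nonneg (zero_le_one.trans hx1) _)] at hx
  linarith

end TAvgOfParts

open TAvgOfParts in
/-- **Stub S3 of line `Sketch`**: the correlation sieve and the three budgets give the hinge `TAvg`
(parameter choice `δ = min (ρ/3) (1/100)`, `ε₁ = δ/8`, `ε = δ/16`; halving induction on the height with
the sieve at each scale `y ∈ [√x, x]`; non-coprime classes and small heights trivially). [this line] -/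
theorem stub_TAvg_of_parts : CorrelationSieveFamily → TIBudget → TIIBudget → TI2Budget → TAvg := by
  intro hS hI hII hI2 h hh
  obtain ⟨ρ, hρ, hI2⟩ := hI2 h hh
  obtain ⟨δ, hδ0, hδ1, hδρ⟩ : ∃ δ : ℝ, 0 < δ ∧ δ ≤ 1 / 100 ∧ 3 * δ ≤ ρ :=
    ⟨min (ρ / 3) (1 / 100), lt_min (by linarith) (by norm_num), min_le_right _ _,
      by linarith [min_le_left (ρ / 3) (1 / 100)]⟩
  obtain ⟨B, Cs, x₀s, hS⟩ := hS δ hδ0 hδ1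
  refine ⟨δ / 16, by positivity, fun A hA => ?_⟩
  have hA' : 0 < A + |Cs| := by positivity
  obtain ⟨C₁, x₁, hI⟩ := hI h hh δ hδ0 (by linarith) (δ / 8) (by positivity) (by linarith) B _ hA'
  obtain ⟨C₂, x₂, hII⟩ := hII h hh δ hδ0 hδ1 (δ / 8) (by positivity) (by linarith) B _ hA'
  obtain ⟨C₃, x₃, hI2⟩ := hI2 δ hδ0 hδρ (δ / 8) (by positivity) (by linarith) B _ hA'
  obtain ⟨K₀, hK₀_def⟩ : ∃ K₀ : ℝ, K₀ = (2 : ℝ) ^ A * |Cs| * (|C₁| + |C₂| + |C₃|) := ⟨_, rfl⟩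
  have hK₀ : 0 ≤ K₀ := by rw [hK₀_def]; positivity
  refine ⟨2 * K₀ + 1, ?_⟩
  obtain ⟨x₀, hx₀⟩ :=
    Filter.eventually_atTop.1 (eventually_thresholds A (max (max x₀s x₁) (max x₂ x₃)))
  refine ⟨x₀, fun x hx y hy0 hyx => ?_⟩
  obtain ⟨hx1, hthr, h9, hlog⟩ := hx₀ x hx
  simp only [max_le_iff] at hthr
  obtain ⟨⟨hT0, hT1⟩, hT2, hT3⟩ := hthr
  have hx0 : 0 < x := by linarith
  obtain ⟨s, hs_def⟩ : ∃ s : ℝ, s = x ^ (1 / 2 : ℝ) := ⟨_, rfl⟩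
  have hsx : s ≤ x := hs_def ▸ Real.rpow_le_self_of_one_le hx1 (by norm_num)
  rw [← hs_def] at hT0 hT1 hT2 hT3 h9
  have hs0 : 0 < s := by linarith
  have hLx : 0 < Real.log x := Real.log_pos (by linarith)
  have hLA : 0 < Real.log x ^ A := Real.rpow_pos_of_pos hLx _
  have hε4 : x ^ (δ / 16) ≤ x ^ (1 / 4 : ℝ) := Real.rpow_le_rpow_of_exponent_le hx1 (by linarith)
  have hxe0 : 0 ≤ x ^ (δ / 16) := Real.rpow_nonneg hx0.le _
  -- the coprime moduli: halving induction
  have hK : 0 ≤ K₀ / Real.log x ^ A := div_nonneg hK₀ hLA.le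
  have hmain : ∑ q ∈ moduliH h (x ^ (δ / 16)), |∑ n ∈ Icc 1 ⌊y⌋₊, Λ n * shiftWeight h q n| ≤
      x ^ (δ / 16) * (s * Real.log x) + 2 * (K₀ / Real.log x ^ A) * y := by
    refine halving_induction
      (L := fun y => ∑ q ∈ moduliH h (x ^ (δ / 16)), |∑ n ∈ Icc 1 ⌊y⌋₊, Λ n * shiftWeight h q n|)
      (P := fun y => ∑ q ∈ moduliH h (x ^ (δ / 16)),
        |∑ n ∈ Ioc ⌊y / 2⌋₊ ⌊y⌋₊, Λ n * shiftWeight h q n|)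
      hs0 hK ?_ (fun y' hsy' _ => sum_abs_le_half_add _ (hs0.le.trans hsy')) ?_ y hy0 hyx
    · intro y' hy0' hyx' hys'
      calc _ ≤ ((moduliH h (x ^ (δ / 16))).card : ℝ) * (y' * Real.log x) :=
            sum_abs_le_card_mul _ hy0' hyx' hx1
        _ ≤ x ^ (δ / 16) * (s * Real.log x) :=
            mul_le_mul (card_filter_Icc_le hxe0 _) (mul_le_mul_of_nonneg_right hys'.le hLx.le)
              (mul_nonneg hy0' hLx.le) hxe0
    · intro y' hsy' hyx'
      have hy'1 : 1 < y' := by linarith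
      have hlog1 : 1 ≤ Real.log y' := by
        rw [Real.le_log_iff_exp_le (by linarith)]
        linarith [Real.exp_one_lt_three]
      have hlog2 : Real.log x ≤ 2 * Real.log y' := by
        have h1 := Real.log_le_log hs0 hsy'
        rw [hs_def, Real.log_rpow hx0] at h1
        linarith
      calc _ ≤ |Cs| * Real.log y' ^ Cs * ((|C₁| + |C₂| + |C₃|) * y' / Real.log y' ^ (A + |Cs|)) :=
            piece_le (hS y' (by linarith)) (hI y' (by linarith)) (hII y' (by linarith))
              (hI2 y' (by linarith)) (rpow_sixteenth_le hx0.le hδ0.le (hs_def ▸ hsy')) hy'1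
        _ ≤ 2 ^ A * |Cs| * (|C₁| + |C₂| + |C₃|) * y' / Real.log x ^ A :=
            const_bookkeeping hlog1 hLx hlog2 hA.le (by positivity) (by linarith)
        _ = K₀ / Real.log x ^ A * y' := by rw [hK₀_def]; ring
  -- the non-coprime moduli
  have hlogN : Real.log ((⌊y⌋₊ : ℕ) : ℝ) ≤ Real.log x := by
    rcases Nat.eq_zero_or_pos ⌊y⌋₊ with h0 | hpos
    · rw [h0, Nat.cast_zero, Real.log_zero]
      exact hLx.le
    · exact Real.log_le_log (by exact_mod_cast hpos) ((Nat.floor_le hy0).trans hyx)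
  have hnc : ∑ q ∈ (Icc 1 ⌊x ^ (δ / 16)⌋₊).filter (fun q : ℕ => ¬ Nat.Coprime q h),
      |∑ n ∈ (Icc 1 ⌊y⌋₊).filter (fun n : ℕ => n ≡ h [MOD q]),
        Λ n * (ArithmeticFunction.liouville (n - h) : ℝ)| ≤ x ^ (δ / 16) * Real.log x := by
    calc _ ≤ ∑ q ∈ (Icc 1 ⌊x ^ (δ / 16)⌋₊).filter (fun q : ℕ => ¬ Nat.Coprime q h), Real.log x :=
          Finset.sum_le_sum fun q hq =>
            (abs_inner_le_log_of_not_coprime hh (Finset.mem_filter.1 hq).2 _).trans hlogN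
      _ ≤ x ^ (δ / 16) * Real.log x := by
          rw [Finset.sum_const, nsmul_eq_mul]
          exact mul_le_mul_of_nonneg_right (card_filter_Icc_le hxe0 _) hLx.le
  -- the final arithmetic
  have hKy : 2 * (K₀ / Real.log x ^ A) * y ≤ 2 * K₀ * x / Real.log x ^ A :=
    calc 2 * (K₀ / Real.log x ^ A) * y ≤ 2 * (K₀ / Real.log x ^ A) * x :=
          mul_le_mul_of_nonneg_left hyx (mul_nonneg two_pos.le hK)
      _ = 2 * K₀ * x / Real.log x ^ A := by ring
  have hsmall : x ^ (δ / 16) * (s * Real.log x) + x ^ (δ / 16) * Real.log x ≤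
      x / Real.log x ^ A := by
    have hs1 : x ^ (δ / 16) * Real.log x ≤ x ^ (δ / 16) * (s * Real.log x) :=
      mul_le_mul_of_nonneg_left (le_mul_of_one_le_left hLx.le (by linarith)) hxe0
    have hpow : Real.log x * Real.log x ^ A = Real.log x ^ (A + 1) := by
      rw [Real.rpow_add hLx, Real.rpow_one, mul_comm]
    have hxx : x ^ (1 / 4 : ℝ) * s * x ^ (1 / 4 : ℝ) = x := by
      rw [hs_def, ← Real.rpow_add hx0, ← Real.rpow_add hx0]
      norm_num
    rw [le_div_iff₀ hLA]
    calc (x ^ (δ / 16) * (s * Real.log x) + x ^ (δ / 16) * Real.log x) * Real.log x ^ A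
        ≤ (2 * (x ^ (δ / 16) * (s * Real.log x))) * Real.log x ^ A :=
          mul_le_mul_of_nonneg_right (by linarith) hLA.le
      _ = x ^ (δ / 16) * s * (2 * Real.log x ^ (A + 1)) := by rw [← hpow]; ring
      _ ≤ x ^ (1 / 4 : ℝ) * s * x ^ (1 / 4 : ℝ) :=
          mul_le_mul (mul_le_mul_of_nonneg_right hε4 hs0.le) hlog
            (mul_nonneg two_pos.le (Real.rpow_nonneg hLx.le _))
            (mul_nonneg (Real.rpow_nonneg hx0.le _) hs0.le)
      _ = x := hxx
  have hsplit : (2 * K₀ + 1) * x / Real.log x ^ A =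
      2 * K₀ * x / Real.log x ^ A + x / Real.log x ^ A := by ring
  rw [← Finset.sum_filter_add_sum_filter_not (Icc 1 ⌊x ^ (δ / 16)⌋₊) (fun q : ℕ => Nat.Coprime q h)]
  have hcop : ∑ q ∈ (Icc 1 ⌊x ^ (δ / 16)⌋₊).filter (fun q : ℕ => Nat.Coprime q h),
      |∑ n ∈ (Icc 1 ⌊y⌋₊).filter (fun n : ℕ => n ≡ h [MOD q]),
        Λ n * (ArithmeticFunction.liouville (n - h) : ℝ)| =
      ∑ q ∈ moduliH h (x ^ (δ / 16)), |∑ n ∈ Icc 1 ⌊y⌋₊, Λ n * shiftWeight h q n| :=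
    Finset.sum_congr rfl fun q _ => by rw [sum_filter_modEq_eq_sum_shiftWeight]
  rw [hcop]
  linarith [hmain, hnc, hKy, hsmall, hsplit]

end Summit.Parity.GeneralizedHardyLittlewood.Theorems.EngineToPairs

end
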